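import Mathlib.Analysis.InnerProductSpace.Calculus
import Mathlib.Analysis.SpecialFunctions.Log.Deriv
import Mathlib.Analysis.SpecialFunctions.Sqrt
import Mathlib.Analysis.Calculus.Deriv.MeanValue
import HarnessLib

/-!
# Escape under quadratic drag: a curve with `‖U''‖ ≤ C ‖U'‖²` and `U' ≠ 0` leaves small balls

Topic `Literature/Analysis/ODE`.  One elementary theorem of real analysis in a real inner product
space `F`, proved (no definitions, no named facts):

* `exists_lt_norm_of_norm_accel_le_mul_sq` — if `U : ℝ → F` has velocity `W = U'` and
  acceleration `A = W'` on `[T₀, ∞)` with `‖A t‖ ≤ C ‖W t‖²` (`C > 0`) and `W t ≠ 0` there, then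
  `1/(2C) < ‖U t‖` for some `t ≥ T₀`: the curve cannot stay in the closed ball of radius `1/(2C)`
  about the origin for all later times.

This is the analytic core of the classical fact that a geodesic of an affine connection cannot be
imprisoned in a sufficiently small coordinate ball, in particular cannot converge to a point as its
affine parameter tends to `+∞` (in a chart the geodesic equation reads `u'' = −Γ(u)(u', u')` with
`Γ` bounded near the centre): O'Neill, *Semi-Riemannian geometry* (1983), Ch. 5, proof of Prop. 7
(p. 130), computes `(N ∘ σ)'' = 2 Σᵢⱼ (δᵢⱼ − Σₖ Γᵏᵢⱼ xᵏ) ẋⁱ ẋʲ > 0` for `N = Σ (xⁱ)²` along a geodesic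
`σ` in a small normal ball; here the same convexity is combined with the comparison `(1/‖U'‖)' ≤ C`.

## Proof

Put `f = ‖U‖²`, so `f' = 2⟪U, W⟫` and `f'' = 2‖W‖² + 2⟪U, A⟫ ≥ 2‖W‖² − 2‖U‖ C ‖W‖² ≥ ‖W‖²` as long
as `‖U‖ ≤ 1/(2C)`.  The function `1/‖W‖` has derivative `−⟪W, A⟫/‖W‖³ ≤ C`, whence
`‖W t‖ ≥ 1/y(t)` with `y(t) = 1/‖W T₀‖ + C (t − T₀)`, and `f'' ≥ 1/y²`.  If `U` stayed in the ball
for all `t ≥ T₀`: (i) `f' ≤ 0` on `[T₀, ∞)` (otherwise, `f'` being non-decreasing, `f → ∞`, but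
`f ≤ 1/(4C²)`); (ii) `h = f' + 1/(C y)` has `h' = f'' − 1/y² ≥ 0`, and `h ≤ 0` (if `h(t₁) > 0` then
`f'(t) ≥ h(t₁) − 1/(C y(t)) > 0` for large `t`, against (i)); (iii) `f + (log y)/C²` has derivative
`h ≤ 0`, so `log y(t) ≤ log y(T₀) + C² f(T₀)` for all `t ≥ T₀`, absurd since `y(t) → ∞`.

## References

* B. O'Neill, *Semi-Riemannian geometry with applications to relativity*, Academic Press 1983,
  Ch. 5, Prop. 7 and Lemma 8 (pp. 129–130).  Key `ONeillSemiRiemannian1983`.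
-/

noncomputable section

open Set Filter
open scoped Topology InnerProductSpace

namespace Literature.Analysis.ODE

/-! ### One-variable calculus on a closed ray from pointwise `HasDerivAt` data -/

/-- A function with a derivative at every point of `[T₀, ∞)` is continuous on `[T₀, ∞)` and
differentiable on its interior, with `deriv` given by the derivative (bookkeeping for the mean value
lemmas of Mathlib). [folklore] -/
lemma continuousOn_Ici_of_hasDerivAt {g g' : ℝ → ℝ} {T₀ : ℝ}
    (hg : ∀ t, T₀ ≤ t → HasDerivAt g (g' t) t) :
    ContinuousOn g (Ici T₀) ∧ DifferentiableOn ℝ g (interior (Ici T₀)) ∧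
      ∀ t ∈ interior (Ici T₀), deriv g t = g' t := by
  refine ⟨fun t ht ↦ (hg t ht).continuousAt.continuousWithinAt, fun t ht ↦ ?_, fun t ht ↦ ?_⟩
  · rw [interior_Ici] at ht
    exact (hg t (le_of_lt ht)).differentiableAt.differentiableWithinAt
  · rw [interior_Ici] at ht
    exact (hg t (le_of_lt ht)).deriv

/-- Monotonicity on `[T₀, ∞)` from a non-negative derivative there. [folklore] -/
lemma monotoneOn_Ici_of_hasDerivAt_nonneg {g g' : ℝ → ℝ} {T₀ : ℝ}
    (hg : ∀ t, T₀ ≤ t → HasDerivAt g (g' t) t) (h0 : ∀ t, T₀ ≤ t → 0 ≤ g' t) :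
    MonotoneOn g (Ici T₀) := by
  obtain ⟨hc, hd, hder⟩ := continuousOn_Ici_of_hasDerivAt hg
  refine monotoneOn_of_deriv_nonneg (convex_Ici T₀) hc hd fun t ht ↦ ?_
  rw [hder t ht]
  rw [interior_Ici] at ht
  exact h0 t (le_of_lt ht)

/-- Antitonicity on `[T₀, ∞)` from a non-positive derivative there. [folklore] -/
lemma antitoneOn_Ici_of_hasDerivAt_nonpos {g g' : ℝ → ℝ} {T₀ : ℝ}
    (hg : ∀ t, T₀ ≤ t → HasDerivAt g (g' t) t) (h0 : ∀ t, T₀ ≤ t → g' t ≤ 0) :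
    AntitoneOn g (Ici T₀) := by
  obtain ⟨hc, hd, hder⟩ := continuousOn_Ici_of_hasDerivAt hg
  refine antitoneOn_of_deriv_nonpos (convex_Ici T₀) hc hd fun t ht ↦ ?_
  rw [hder t ht]
  rw [interior_Ici] at ht
  exact h0 t (le_of_lt ht)

/-- Linear lower growth on `[T₀, ∞)` from a lower bound `K ≤ g'` there:
`K (t − s) ≤ g t − g s` for `T₀ ≤ s ≤ t`. [folklore] -/
lemma mul_sub_le_sub_of_le_hasDerivAt {g g' : ℝ → ℝ} {T₀ K : ℝ}
    (hg : ∀ t, T₀ ≤ t → HasDerivAt g (g' t) t) (hK : ∀ t, T₀ ≤ t → K ≤ g' t)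
    {s t : ℝ} (hs : T₀ ≤ s) (hst : s ≤ t) : K * (t - s) ≤ g t - g s := by
  obtain ⟨hc, hd, hder⟩ := continuousOn_Ici_of_hasDerivAt hg
  refine (convex_Ici T₀).mul_sub_le_image_sub_of_le_deriv hc hd (fun x hx ↦ ?_) s hs t
    (hs.trans hst) hst
  rw [hder x hx]
  rw [interior_Ici] at hx
  exact hK x (le_of_lt hx)

/-- Linear upper growth on `[T₀, ∞)` from an upper bound `g' ≤ K` there:
`g t − g s ≤ K (t − s)` for `T₀ ≤ s ≤ t`. [folklore] -/
lemma sub_le_mul_sub_of_hasDerivAt_le {g g' : ℝ → ℝ} {T₀ K : ℝ}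
    (hg : ∀ t, T₀ ≤ t → HasDerivAt g (g' t) t) (hK : ∀ t, T₀ ≤ t → g' t ≤ K)
    {s t : ℝ} (hs : T₀ ≤ s) (hst : s ≤ t) : g t - g s ≤ K * (t - s) := by
  obtain ⟨hc, hd, hder⟩ := continuousOn_Ici_of_hasDerivAt hg
  refine (convex_Ici T₀).image_sub_le_mul_sub_of_deriv_le hc hd (fun x hx ↦ ?_) s hs t
    (hs.trans hst) hst
  rw [hder x hx]
  rw [interior_Ici] at hx
  exact hK x (le_of_lt hx)

/-! ### The speed cannot decay faster than `1/t` -/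

/-- **Comparison for the speed.**  If `W' = A` with `‖A‖ ≤ C ‖W‖²` and `W ≠ 0` on `[T₀, ∞)`, then
`1/‖W‖` has derivative `≤ C`, whence `‖W t‖ ≥ 1 / (1/‖W T₀‖ + C (t − T₀))` for `t ≥ T₀`. [folklore] -/
lemma one_div_le_norm_of_norm_deriv_le_mul_sq {F : Type*} [NormedAddCommGroup F]
    [InnerProductSpace ℝ F] {W A : ℝ → F} {T₀ C : ℝ} (hC : 0 ≤ C)
    (hW : ∀ t, T₀ ≤ t → HasDerivAt W (A t) t)
    (hA : ∀ t, T₀ ≤ t → ‖A t‖ ≤ C * ‖W t‖ ^ 2) (hW0 : ∀ t, T₀ ≤ t → W t ≠ 0)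
    {t : ℝ} (ht : T₀ ≤ t) : 1 / (1 / ‖W T₀‖ + C * (t - T₀)) ≤ ‖W t‖ := by
  -- `R = 1/‖W‖` and its derivative `R' = -⟪W, A⟫ / ‖W‖ ^ 3 ≤ C`
  set R : ℝ → ℝ := fun s ↦ 1 / ‖W s‖ with hR
  set R' : ℝ → ℝ := fun s ↦ -(⟪W s, A s⟫_ℝ / ‖W s‖) / ‖W s‖ ^ 2 with hR'
  have hnorm : ∀ s, T₀ ≤ s → HasDerivAt (fun s ↦ ‖W s‖) (⟪W s, A s⟫_ℝ / ‖W s‖) s := by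
    intro s hs
    have hpos : 0 < ‖W s‖ := norm_pos_iff.mpr (hW0 s hs)
    have h1 : HasDerivAt (fun s ↦ ‖W s‖ ^ 2) (2 * ⟪W s, A s⟫_ℝ) s := (hW s hs).norm_sq
    have h2 : HasDerivAt (fun s ↦ Real.sqrt (‖W s‖ ^ 2))
        (2 * ⟪W s, A s⟫_ℝ / (2 * Real.sqrt (‖W s‖ ^ 2))) s := h1.sqrt (by positivity)
    have h3 : (fun s ↦ Real.sqrt (‖W s‖ ^ 2)) = fun s ↦ ‖W s‖ := by
      funext s; exact Real.sqrt_sq (norm_nonneg _)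
    rw [h3, Real.sqrt_sq hpos.le] at h2
    convert h2 using 1
    field_simp
  have hRd : ∀ s, T₀ ≤ s → HasDerivAt R (R' s) s := by
    intro s hs
    have hpos : 0 < ‖W s‖ := norm_pos_iff.mpr (hW0 s hs)
    have h := (hnorm s hs).inv hpos.ne'
    simp only [hR, hR', one_div]
    exact h
  have hR'le : ∀ s, T₀ ≤ s → R' s ≤ C := by
    intro s hs
    have hpos : 0 < ‖W s‖ := norm_pos_iff.mpr (hW0 s hs)
    have hin : |⟪W s, A s⟫_ℝ| ≤ ‖W s‖ * ‖A s‖ := abs_real_inner_le_norm _ _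
    have hAs := hA s hs
    have h1 : R' s = -⟪W s, A s⟫_ℝ / ‖W s‖ ^ 3 := by
      simp only [hR']
      field_simp
    rw [h1, div_le_iff₀ (by positivity)]
    have h2 : -⟪W s, A s⟫_ℝ ≤ ‖W s‖ * ‖A s‖ := by
      have := (abs_le.mp hin).1
      linarith
    calc -⟪W s, A s⟫_ℝ ≤ ‖W s‖ * ‖A s‖ := h2
      _ ≤ ‖W s‖ * (C * ‖W s‖ ^ 2) := mul_le_mul_of_nonneg_left hAs hpos.le
      _ = C * ‖W s‖ ^ 3 := by ring
  -- integrate: `R t ≤ R T₀ + C (t - T₀)`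
  have hRt : R t - R T₀ ≤ C * (t - T₀) := sub_le_mul_sub_of_hasDerivAt_le hRd hR'le le_rfl ht
  have hpos : 0 < ‖W t‖ := norm_pos_iff.mpr (hW0 t ht)
  have hpos₀ : 0 < ‖W T₀‖ := norm_pos_iff.mpr (hW0 T₀ le_rfl)
  have hy : 0 < 1 / ‖W T₀‖ + C * (t - T₀) := by
    have : 0 ≤ C * (t - T₀) := mul_nonneg hC (sub_nonneg.mpr ht)
    positivity
  have hRt' : 1 / ‖W t‖ ≤ 1 / ‖W T₀‖ + C * (t - T₀) := by
    have : R t ≤ R T₀ + C * (t - T₀) := by linarith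
    simpa only [hR] using this
  rw [div_le_iff₀ hy]
  have := (div_le_iff₀ hpos).mp hRt'
  linarith

/-! ### The escape theorem -/

/-- **Escape under quadratic drag.**  In a real inner product space, a curve `U` with velocity
`W = U'` and acceleration `A = W'` on `[T₀, ∞)` satisfying `‖A t‖ ≤ C ‖W t‖²` (`C > 0`), with `W`
nowhere zero there, satisfies `1/(2C) < ‖U t‖` at some time `t ≥ T₀` — it cannot stay in the closed
ball of radius `1/(2C)` about the origin.  (The analytic core of "a geodesic is not imprisoned in a
small coordinate ball": O'Neill 1983, Ch. 5, proof of Prop. 7, p. 130, `(N∘σ)'' > 0`, plus the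
comparison `(1/‖U'‖)' ≤ C`; see the module docstring for the proof.) [cite: ONeillSemiRiemannian1983, Ch. 5, Prop. 7 (proof, p. 130)] -/
theorem exists_lt_norm_of_norm_accel_le_mul_sq {F : Type*} [NormedAddCommGroup F]
    [InnerProductSpace ℝ F] {U W A : ℝ → F} {T₀ C : ℝ} (hC : 0 < C)
    (hU : ∀ t, T₀ ≤ t → HasDerivAt U (W t) t) (hW : ∀ t, T₀ ≤ t → HasDerivAt W (A t) t)
    (hA : ∀ t, T₀ ≤ t → ‖A t‖ ≤ C * ‖W t‖ ^ 2) (hW0 : ∀ t, T₀ ≤ t → W t ≠ 0) :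
    ∃ t, T₀ ≤ t ∧ 1 / (2 * C) < ‖U t‖ := by
  by_contra hcon
  push Not at hcon
  -- `hcon : ∀ t, T₀ ≤ t → ‖U t‖ ≤ 1 / (2 * C)`
  -- the comparison function `y` and the speed bound
  set y : ℝ → ℝ := fun t ↦ 1 / ‖W T₀‖ + C * (t - T₀) with hy_def
  have hm₀ : 0 < ‖W T₀‖ := norm_pos_iff.mpr (hW0 T₀ le_rfl)
  have hy_pos : ∀ t, T₀ ≤ t → 0 < y t := fun t ht ↦ by
    have : 0 ≤ C * (t - T₀) := mul_nonneg hC.le (sub_nonneg.mpr ht)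
    simp only [hy_def]; positivity
  have hy_ge : ∀ t, T₀ ≤ t → C * (t - T₀) ≤ y t := fun t ht ↦ by
    simp only [hy_def]; have := one_div_pos.mpr hm₀; linarith
  have hyd : ∀ t, HasDerivAt y C t := fun t ↦ by
    have h := ((hasDerivAt_id' t).sub_const T₀).const_mul C |>.const_add (1 / ‖W T₀‖)
    simpa only [hy_def, mul_one] using h
  have hspeed : ∀ t, T₀ ≤ t → 1 / y t ≤ ‖W t‖ := fun t ht ↦
    one_div_le_norm_of_norm_deriv_le_mul_sq hC.le hW hA hW0 ht
  -- `f = ‖U‖²`, `f' = 2⟪U, W⟫`, `f'' = 2(⟪U, A⟫ + ⟪W, W⟫)`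
  set f : ℝ → ℝ := fun t ↦ ‖U t‖ ^ 2 with hf_def
  set f' : ℝ → ℝ := fun t ↦ 2 * ⟪U t, W t⟫_ℝ with hf'_def
  set f'' : ℝ → ℝ := fun t ↦ 2 * (⟪U t, A t⟫_ℝ + ⟪W t, W t⟫_ℝ) with hf''_def
  have hfd : ∀ t, T₀ ≤ t → HasDerivAt f (f' t) t := fun t ht ↦ (hU t ht).norm_sq
  have hf'd : ∀ t, T₀ ≤ t → HasDerivAt f' (f'' t) t := fun t ht ↦
    ((hU t ht).inner ℝ (hW t ht)).const_mul 2
  have hf_nonneg : ∀ t, 0 ≤ f t := fun t ↦ by simp only [hf_def]; positivity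
  have hf_le : ∀ t, T₀ ≤ t → f t ≤ (1 / (2 * C)) ^ 2 := fun t ht ↦ by
    simp only [hf_def]
    exact pow_le_pow_left₀ (norm_nonneg _) (hcon t ht) 2
  -- `f'' ≥ ‖W‖² ≥ 1/y²`
  have hf''ge : ∀ t, T₀ ≤ t → 1 / y t ^ 2 ≤ f'' t := by
    intro t ht
    have hWW : ⟪W t, W t⟫_ℝ = ‖W t‖ ^ 2 := real_inner_self_eq_norm_sq _
    have hUA : -(‖U t‖ * ‖A t‖) ≤ ⟪U t, A t⟫_ℝ := (abs_le.mp (abs_real_inner_le_norm _ _)).1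
    have hU1 : ‖U t‖ ≤ 1 / (2 * C) := hcon t ht
    have hA1 := hA t ht
    have hUA' : ‖U t‖ * ‖A t‖ ≤ 1 / (2 * C) * (C * ‖W t‖ ^ 2) :=
      mul_le_mul hU1 hA1 (norm_nonneg _) (by positivity)
    have hhalf : 1 / (2 * C) * (C * ‖W t‖ ^ 2) = ‖W t‖ ^ 2 / 2 := by field_simp
    have h1 : ‖W t‖ ^ 2 ≤ f'' t := by
      simp only [hf''_def]; rw [hWW]; linarith
    have h2 : 1 / y t ^ 2 ≤ ‖W t‖ ^ 2 := by
      have hsp := hspeed t ht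
      have hyp := hy_pos t ht
      have h3 : (1 / y t) ^ 2 ≤ ‖W t‖ ^ 2 := pow_le_pow_left₀ (by positivity) hsp 2
      simpa only [one_div, inv_pow] using h3
    exact h2.trans h1
  -- (i) `f' ≤ 0` on `[T₀, ∞)`
  have hf'le : ∀ t, T₀ ≤ t → f' t ≤ 0 := by
    intro t₁ ht₁
    by_contra hpos
    push Not at hpos
    -- `f'` is non-decreasing on `[T₀, ∞)`, hence `≥ f' t₁ > 0` after `t₁`
    have hmono : MonotoneOn f' (Ici T₀) := monotoneOn_Ici_of_hasDerivAt_nonneg hf'd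
      fun t ht ↦ le_trans (by have := hy_pos t ht; positivity) (hf''ge t ht)
    have hgrow : ∀ t, t₁ ≤ t → f' t₁ * (t - t₁) ≤ f t - f t₁ := fun t ht ↦
      mul_sub_le_sub_of_le_hasDerivAt (T₀ := t₁) (fun s hs ↦ hfd s (ht₁.trans hs))
        (fun s hs ↦ hmono (show T₀ ≤ t₁ from ht₁) (ht₁.trans hs) hs) le_rfl ht
    -- at `t = t₁ + ((1/(2C))² + 1)/f' t₁` the bound `f ≤ (1/(2C))²` is violated
    set B : ℝ := (1 / (2 * C)) ^ 2 with hB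
    have ht : t₁ ≤ t₁ + (B + 1) / f' t₁ := by
      have : 0 ≤ (B + 1) / f' t₁ := by positivity
      linarith
    have h1 := hgrow _ ht
    have h2 : f' t₁ * (t₁ + (B + 1) / f' t₁ - t₁) = B + 1 := by field_simp; ring
    rw [h2] at h1
    have h3 := hf_le _ (ht₁.trans ht)
    have h4 := hf_nonneg t₁
    linarith
  -- (ii) `h = f' + 1/(C y)` is non-decreasing and `≤ 0`
  set h : ℝ → ℝ := fun t ↦ f' t + 1 / (C * y t) with hh_def
  set h' : ℝ → ℝ := fun t ↦ f'' t - 1 / y t ^ 2 with hh'_def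
  have hhd : ∀ t, T₀ ≤ t → HasDerivAt h (h' t) t := by
    intro t ht
    have hyp := hy_pos t ht
    have h1 : HasDerivAt (fun s ↦ C * y s) (C * C) t := (hyd t).const_mul C
    have h2 : HasDerivAt (fun s ↦ (C * y s)⁻¹) (-(C * C) / (C * y t) ^ 2) t :=
      h1.inv (by positivity)
    have h3 := (hf'd t ht).add h2
    have h4 : f'' t + -(C * C) / (C * y t) ^ 2 = h' t := by
      simp only [hh'_def]; field_simp; ring
    rw [h4] at h3
    have h5 : h = fun s ↦ f' s + (C * y s)⁻¹ := by
      funext s; simp only [hh_def, one_div]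
    rw [h5]
    exact h3
  have hmono_h : MonotoneOn h (Ici T₀) :=
    monotoneOn_Ici_of_hasDerivAt_nonneg hhd fun t ht ↦ by
      simp only [hh'_def]; linarith [hf''ge t ht]
  have hhle : ∀ t, T₀ ≤ t → h t ≤ 0 := by
    intro t₁ ht₁
    by_contra hpos
    push Not at hpos
    -- for `t ≥ t₁` : `f' t ≥ h t₁ - 1/(C y t)`, positive for `t` large
    set t : ℝ := max t₁ (T₀ + 2 / (C * C * h t₁)) with ht_def
    have ht₁t : t₁ ≤ t := le_max_left _ _
    have hT₀t : T₀ ≤ t := ht₁.trans ht₁t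
    have h1 : h t₁ ≤ h t := hmono_h (show T₀ ≤ t₁ from ht₁) hT₀t ht₁t
    have hyt : 2 / (C * h t₁) ≤ y t := by
      have h2 : T₀ + 2 / (C * C * h t₁) ≤ t := le_max_right _ _
      have h3 : C * (2 / (C * C * h t₁)) ≤ C * (t - T₀) :=
        mul_le_mul_of_nonneg_left (by linarith) hC.le
      have h4 : C * (2 / (C * C * h t₁)) = 2 / (C * h t₁) := by field_simp
      linarith [hy_ge t hT₀t]
    have hyt_pos := hy_pos t hT₀t
    have h5 : 1 / (C * y t) ≤ h t₁ / 2 := by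
      rw [div_le_iff₀ (by positivity)]
      have := (div_le_iff₀ (by positivity : 0 < C * h t₁)).mp hyt
      nlinarith
    have h6 : f' t = h t - 1 / (C * y t) := by simp only [hh_def]; ring
    have h7 : 0 < f' t := by rw [h6]; linarith
    exact absurd (hf'le t hT₀t) (not_le.mpr h7)
  -- (iii) `G = f + (log y)/C²` is non-increasing: `log y` is bounded above on `[T₀, ∞)` — absurd
  set G : ℝ → ℝ := fun t ↦ f t + Real.log (y t) / C ^ 2 with hG_def
  have hGd : ∀ t, T₀ ≤ t → HasDerivAt G (h t) t := by
    intro t ht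
    have hyp := hy_pos t ht
    have h1 : HasDerivAt (fun s ↦ Real.log (y s)) (C / y t) t := (hyd t).log hyp.ne'
    have h2 := (hfd t ht).add (h1.div_const (C ^ 2))
    have h3 : f' t + C / y t / C ^ 2 = h t := by simp only [hh_def]; field_simp
    rw [h3] at h2
    exact h2
  have hanti : AntitoneOn G (Ici T₀) := antitoneOn_Ici_of_hasDerivAt_nonpos hGd hhle
  -- choose `t` with `log (y t) > log (y T₀) + C² f T₀`
  set Λ : ℝ := Real.log (y T₀) + C ^ 2 * f T₀ with hΛ
  set t : ℝ := T₀ + Real.exp Λ / C with ht_def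
  have hT₀t : T₀ ≤ t := by
    have : 0 ≤ Real.exp Λ / C := by positivity
    simp only [ht_def]; linarith
  have hyt : y t = 1 / ‖W T₀‖ + Real.exp Λ := by
    simp only [hy_def, ht_def]; field_simp; ring
  have hlog : Λ < Real.log (y t) := by
    rw [hyt]
    have h1 : Real.exp Λ < 1 / ‖W T₀‖ + Real.exp Λ := by
      have := one_div_pos.mpr hm₀; linarith
    calc Λ = Real.log (Real.exp Λ) := (Real.log_exp Λ).symm
      _ < Real.log (1 / ‖W T₀‖ + Real.exp Λ) := Real.log_lt_log (Real.exp_pos Λ) h1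
  have hG : G t ≤ G T₀ := hanti (Set.mem_Ici.mpr le_rfl) hT₀t hT₀t
  have hG' : f t + Real.log (y t) / C ^ 2 ≤ f T₀ + Real.log (y T₀) / C ^ 2 := by
    simpa only [hG_def] using hG
  have hft := hf_nonneg t
  have hC2 : 0 < C ^ 2 := by positivity
  have h1 : Real.log (y t) ≤ Λ := by
    have h2 : Real.log (y t) / C ^ 2 ≤ f T₀ + Real.log (y T₀) / C ^ 2 := by linarith
    have h3 := (div_le_iff₀ hC2).mp h2
    have h4 : (f T₀ + Real.log (y T₀) / C ^ 2) * C ^ 2 = Real.log (y T₀) + C ^ 2 * f T₀ := by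
      field_simp
      ring
    rw [h4] at h3
    simpa only [hΛ] using h3
  linarith

end Literature.Analysis.ODE

end
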